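import Summits.QuantumFields.YangMills.Theorems.LangevinControlUVFemtoCurvatureTwoPointCDefsSplit
import Summits.QuantumFields.YangMills.Theorems.LangevinControlUVFemtoCurvatureTwoPointStubDoublingOfRV
import Summits.QuantumFields.YangMills.Theorems.LangevinControlUVFemtoCurvatureTwoPointStubVarianceOfChessboardDoubling
import Literature.MathematicalPhysics.QuantumFieldTheory.WilsonPartitionRegularVariation

/-!
# Route `LangevinControlUV`, crux `FemtoCurvatureTwoPointC` (stmt-QuantumFields-16204), line `Sketch` —
# the small-torus variance law from regular variation of the fixed-torus partition function

Registered sub-goal `smallTorusVarianceLaw_of_RV` (skeleton v5, `--supports stmt-QuantumFields-16204`):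

  `WilsonPartitionRegularVariation → SmallTorusVarianceLaw`,

i.e. the bare-coupling law `Var_{L,β}(P_0^{01}) ≤ K/β²` (`β ≥ β₀`, one `K`, one `β₀`) on the six small
tori `2 ≤ L ≤ 7`, CONDITIONALLY on the Literature named fact `WilsonPartitionRegularVariation`
(`Z_L(β) β^λ/(log β)^m → C > 0`, Laplace asymptotics with analytic phase). Here
`P_0^{01}(U) = N − Re tr r.ρ(U_{0;01}) ∈ [0, 2N]` is one term of Wilson's action `S(U) = ∑ₚ (N − Re tr r.ρ(U_p))`.

Proof (no chessboard estimate is needed — a crude Chebyshev-type bound suffices on finitely many tori):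

* doubling (landed `FemtoCurvatureTwoPoint.stub_doubling_of_RV`, whose hypothesis is verbatim the body of the
  named fact): ONE `A` with `Z_L(β/2) ≤ e^{A L⁴} Z_L(β)` for `β ≥ B(L)`, every `L`;
* pointwise `0 ≤ P_0^{01} ≤ S` (a single non-negative term of the sum) and the moment bound
  `S² ≤ (4/(eβ))² e^{βS/2}` (`PlaquetteVariance.div_pow_le_mul_exp`, `k = 1`), so
  `⟨(P_0^{01})²⟩_β ≤ (4/(eβ))² ⟨e^{βS/2}⟩_β = (4/(eβ))² Z_L(β/2)/Z_L(β) ≤ 16 e^{A L⁴}/(e² β²)`;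
* `Var P = ⟨P·P⟩ − ⟨P⟩² ≤ |⟨P·P⟩ − ⟨P⟩²| ≤ ⟨P²⟩` (`PlaquetteVariance.abs_var_le_wilsonExpectation_sq`);
* constants: `K := 16 e^{|A|·7⁴}/e²` (`A L⁴ ≤ |A| 7⁴` for `L ≤ 7`) and `β₀ := 1 + ∑_{n<8} |B(n)|`
  (so `β ≥ β₀` gives `β ≥ B(L)` for `L < 8` and `β ≥ 1 > 0`).

The hypothesis `IsCompactSimpleLieGroup G` of `SmallTorusVarianceLaw` is not used.
-/

set_option autoImplicit false

noncomputable section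

open MeasureTheory Filter Topology
open Literature.MathematicalPhysics.QuantumFieldTheory
open Summit.QuantumFields.YangMills.Theorems.FemtoCurvatureTwoPoint.PlaquetteVariance

namespace Summit.QuantumFields.YangMills.Theorems.FemtoCurvatureTwoPointC

section Helpers

variable {G : Type*} [Group G] [TopologicalSpace G] [IsTopologicalGroup G] [CompactSpace G]
  {N : ℕ} (ρ : G →* Matrix (Fin N) (Fin N) ℂ)

/-- Pointwise bound on the squared `01`-plaquette field at the origin:
`P_0(U)² ≤ S(U)² ≤ (4/(eβ))² · e^{β S(U)/2}` (`0 ≤ P_0 ≤ S`, a single non-negative term of the Wilson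
action, and the moment bound `s² ≤ (4/(eβ))² e^{βs/2}`). [folklore] -/
theorem plaq01_sq_le_sq_mul_exp (hρ : Continuous ρ) {L : ℕ} [NeZero L] {β : ℝ} (hβ : 0 < β)
    (U : GaugeConfig 4 L G) :
    ((N : ℝ) - (ρ (plaquetteHolonomy U 0 0 1)).trace.re) ^ 2 ≤
      (4 / (Real.exp 1 * β)) ^ 2 * Real.exp (β / 2 * wilsonAction ρ U) := by
  have hρN := re_trace_le ρ hρ
  have h0 : ∀ g, 0 ≤ (N : ℝ) - (ρ g).trace.re := fun g => sub_nonneg.2 (hρN g)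
  have hPS : (N : ℝ) - (ρ (plaquetteHolonomy U 0 0 1)).trace.re ≤ wilsonAction ρ U := by
    refine le_trans ?_ (sum_plaq01_le_wilsonAction ρ hρN U)
    exact Finset.single_le_sum
      (f := fun x : Site 4 L => (N : ℝ) - (ρ (plaquetteHolonomy U x 0 1)).trace.re)
      (fun x _ => h0 _) (Finset.mem_univ (0 : Site 4 L))
  have hS0 : 0 ≤ wilsonAction ρ U := le_trans (h0 _) hPS
  have hmom := div_pow_le_mul_exp hS0 hβ one_pos
  simp only [Nat.cast_one, div_one, mul_one] at hmom
  exact (pow_le_pow_left₀ (h0 _) hPS 2).trans hmom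

variable [MeasurableSpace G] [BorelSpace G]

/-- **`⟨P_0²⟩_β ≤ (4/(eβ))² · Z(β/2)/Z(β)`** for the `01`-plaquette field at the origin (integrate the
pointwise bound `plaq01_sq_le_sq_mul_exp` against Wilson's probability measure and use
`⟨e^{βS/2}⟩_β = Z(β/2)/Z(β)`; only the right-hand side needs to be integrable). [folklore] -/
theorem wilsonExpectation_plaq01_sq_le (hρ : Continuous ρ) {L : ℕ} [NeZero L] {β : ℝ}
    (hβ : 0 < β) :
    wilsonExpectation ρ β (fun U : GaugeConfig 4 L G =>
        ((N : ℝ) - (ρ (plaquetteHolonomy U 0 0 1)).trace.re) ^ 2) ≤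
      (4 / (Real.exp 1 * β)) ^ 2 *
        ((partitionFunction (d := 4) (L := L) ρ (β / 2)).toReal /
          (partitionFunction (d := 4) (L := L) ρ β).toReal) := by
  haveI := isProbabilityMeasure_wilsonMeasure (d := 4) (L := L) ρ hρ β
  rw [← wilsonExpectation_exp_half_mul ρ hρ β]
  unfold wilsonExpectation
  rw [← integral_const_mul]
  refine integral_mono_of_nonneg (ae_of_all _ fun U => ?_)
    ((integrable_exp_mul_wilsonAction ρ hρ (β / 2) _).const_mul _) (ae_of_all _ fun U => ?_)
  · exact sq_nonneg _
  · exact plaq01_sq_le_sq_mul_exp ρ hρ hβ U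

end Helpers

/-- **The small-torus variance law from regular variation of `Z_L`** (registered sub-goal of line
`Sketch`, crux `FemtoCurvatureTwoPointC`, stmt-QuantumFields-16204; conditional on the Literature named
fact `WilsonPartitionRegularVariation` by design). For every compact `G`, every lattice representation
`r`: with the doubling constant `A` and thresholds `B(L)` of `FemtoCurvatureTwoPoint.stub_doubling_of_RV`,
`Var_{L,β}(P_0^{01}) ≤ ⟨(P_0^{01})²⟩_β ≤ (4/(eβ))² Z_L(β/2)/Z_L(β) ≤ 16 e^{|A| 7⁴}/(e² β²)` for
`2 ≤ L ≤ 7` and `β ≥ 1 + ∑_{n<8} |B(n)|`. [folklore] -/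
theorem smallTorusVarianceLaw_of_RV :
    Literature.MathematicalPhysics.QuantumFieldTheory.WilsonPartitionRegularVariation → SmallTorusVarianceLaw := by
  intro hRV G i1 i2 i3 i4 i5 i6 _hG r
  -- doubling thresholds `B L` (junk value at `L = 0`) and the constant `A`
  obtain ⟨A, hA⟩ :=
    Summit.QuantumFields.YangMills.Theorems.FemtoCurvatureTwoPoint.stub_doubling_of_RV hRV G r
  have hA' : ∀ L : ℕ, ∃ B : ℝ, ∀ β : ℝ, B ≤ β → ∀ [NeZero L],
      (partitionFunction (d := 4) (L := L) r.ρ (β / 2)).toReal ≤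
        Real.exp (A * (L : ℝ) ^ 4) * (partitionFunction (d := 4) (L := L) r.ρ β).toReal := by
    intro L
    by_cases hL0 : L = 0
    · refine ⟨0, fun β _ => ?_⟩
      intro _
      exact absurd hL0 (NeZero.ne L)
    · haveI : NeZero L := ⟨hL0⟩
      obtain ⟨B, hB⟩ := hA L
      refine ⟨B, fun β hβ => ?_⟩
      intro _
      exact hB β hβ
  choose B hB using hA'
  refine ⟨16 * Real.exp (|A| * 7 ^ 4) / Real.exp 1 ^ 2, 1 + ∑ n ∈ Finset.range 8, |B n|, ?_⟩
  intro L iL β _hL2 hL8 hβ P E hP hE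
  subst hP hE
  dsimp only
  -- thresholds: `B L ≤ β` and `1 ≤ β`
  have hBL : B L ≤ β := by
    have h1 : |B L| ≤ ∑ n ∈ Finset.range 8, |B n| :=
      Finset.single_le_sum (f := fun n => |B n|) (fun n _ => abs_nonneg (B n))
        (Finset.mem_range.2 hL8)
    linarith [le_abs_self (B L)]
  have hβ1 : 1 ≤ β := by
    have h0 : 0 ≤ ∑ n ∈ Finset.range 8, |B n| := Finset.sum_nonneg fun n _ => abs_nonneg (B n)
    linarith
  have hβ0 : 0 < β := lt_of_lt_of_le one_pos hβ1
  have hdbl : (partitionFunction (d := 4) (L := L) r.ρ (β / 2)).toReal ≤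
      Real.exp (A * (L : ℝ) ^ 4) * (partitionFunction (d := 4) (L := L) r.ρ β).toReal :=
    hB L β hBL
  -- (i) `Var P ≤ |Var P| ≤ ⟨P²⟩`
  have hXm := measurable_plaq01 r.ρ r.continuous (0 : Site 4 L)
  have hXb : ∀ U : GaugeConfig 4 L G,
      |(r.N : ℝ) - (r.ρ (plaquetteHolonomy U 0 0 1)).trace.re| ≤ 2 * r.N := fun U => by
    obtain ⟨h0, h2⟩ := plaqField_mem r.ρ r.continuous (plaquetteHolonomy U 0 0 1)
    rw [abs_of_nonneg h0]
    exact h2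
  have hvar := abs_var_le_wilsonExpectation_sq r.ρ r.continuous β hXm hXb
  -- (ii) `⟨P²⟩ ≤ (4/(eβ))² Z(β/2)/Z(β)`
  have hsq := wilsonExpectation_plaq01_sq_le (L := L) r.ρ r.continuous hβ0
  -- (iii) `Z(β/2)/Z(β) ≤ e^{A L⁴} ≤ e^{|A| 7⁴}`
  have hZ := partitionFunction_toReal_pos (d := 4) (L := L) r.ρ r.continuous β
  have hratio : (partitionFunction (d := 4) (L := L) r.ρ (β / 2)).toReal /
      (partitionFunction (d := 4) (L := L) r.ρ β).toReal ≤ Real.exp (|A| * 7 ^ 4) := by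
    rw [div_le_iff₀ hZ]
    refine hdbl.trans (mul_le_mul_of_nonneg_right (Real.exp_le_exp.2 ?_) hZ.le)
    have hL7 : (L : ℝ) ≤ 7 := by exact_mod_cast Nat.lt_succ_iff.1 hL8
    have hL0 : (0 : ℝ) ≤ L := Nat.cast_nonneg L
    calc A * (L : ℝ) ^ 4 ≤ |A| * (L : ℝ) ^ 4 :=
          mul_le_mul_of_nonneg_right (le_abs_self A) (by positivity)
      _ ≤ |A| * 7 ^ 4 := mul_le_mul_of_nonneg_left (pow_le_pow_left₀ hL0 hL7 4) (abs_nonneg A)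
  -- assembly
  have hβne : β ≠ 0 := hβ0.ne'
  calc _ ≤ (4 / (Real.exp 1 * β)) ^ 2 * Real.exp (|A| * 7 ^ 4) :=
        (le_abs_self _).trans
          (hvar.trans (hsq.trans (mul_le_mul_of_nonneg_left hratio (by positivity))))
    _ = 16 * Real.exp (|A| * 7 ^ 4) / Real.exp 1 ^ 2 / β ^ 2 := by
        field_simp
        ring

end Summit.QuantumFields.YangMills.Theorems.FemtoCurvatureTwoPointC

end
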